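/-
Copyright (c) 2026 the pub-hodgecm-mathlib formalisation cell (harness21).  Prover seat hodgecm-mathlib-F0P3-p04 (g12); architect A-p16 (g30) A-130 (2)
(the support organ for the rider `stub_twoDeepRep_typeTwo`, END fold v3.2 :320), 2026-09-01.
-/
import Literature.NumberTheory.Rogawski1990.UnitFundamentalLemmaInertIrredClauseOfValues   -- ★ `mk_mem_conjClassesIn_of_finExplicitDelta_ne_zero` (Δ‴ charges only the stable class)
import Literature.NumberTheory.Rogawski1990.UnitFundamentalLemmaInertSplitClauseOfValues   -- ★ `mk_mem_conjClassesIn_of_isLocalNormPair`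
import Literature.NumberTheory.Rogawski1990.LocalStableClassesNonsplitTypeTwoCount          -- ★ `exists_isStablyConj_not_isConj_and_forall` (type (2): exactly two classes)
import HarnessLib

/-!
# The `Δ‴`-support on a type-(2) stable class is the two matched classes (road «S3-tree», LIFT rider (H2D) `stub_twoDeepRep_typeTwo`, organ (i))

Topic `NumberTheory/Rogawski1990`.  KERNEL lane: THEOREMS ONLY (no `def`, no instance, no notation, no named fact, no `sorry`); `--supports stmt-HodgeConjecture-24833`.
HONEST LABEL: HC_CM is proved only modulo the 2 remaining named inputs (hLiu418 24832, h413 24833) until rung 0 closes; this file pays no letter by itself.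

THE MATHEMATICS.  The type-(2) twin of ★ `mk_eq_or_of_finExplicitDelta_out_ne_zero` (`TwoDeepRepresentativesTypeOneOrgans`, four classes): at a non-split place, if
`t₁, t₂ ∈ G′_v` are both matched with `ι_v(γ_H)` (`IsLocalNormPair`), `t₁` carries a type-(2) block frame `t₁ P = P [A 0; 0 u]` with `χ_A` IRREDUCIBLE, and `t₁ ≁ t₂`, then every
conjugacy class `c` with `Δ‴_v(γ_H, out c) ≠ 0` is `⟦t₁⟧` or `⟦t₂⟧`: `Δ‴` vanishes off the stable class of `t₁` (★ `mk_mem_conjClassesIn_of_finExplicitDelta_ne_zero`), and that stable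
class consists of EXACTLY TWO classes (★ `exists_isStablyConj_not_isConj_and_forall`: a realised non-norm corner `δ₀ ≁ t₁` with «every stable conjugate is conjugate to `t₁` or to
`δ₀`» — so `t₂ ∼ δ₀`) [Rogawski1990, §3.5 Prop. 3.5.2 (c) p. 29 («`|𝓡(T∕F)| = 2^{r−1}`, `r = 2`»); §4.3 (4.3.1)–(4.3.2) p. 43].  This is the SUPPORT half of the rider; the other half
(a `K`-representative `≡ 1 (ϖ²)` of each of the two classes at 3-deep `γ_H`) is the representative organ.

## References
* [Rogawski1990] J. D. Rogawski, *Automorphic Representations of Unitary Groups in Three Variables*, Ann. of Math. Stud. 123 (1990), §3.5 Prop. 3.5.2 (c) p. 29,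
  §4.3 (4.3.1)–(4.3.2) p. 43, §4.9 Prop. 4.9.1 (b) p. 55.
* [Flicker1998UnitaryFL] Y. Z. Flicker, *Elementary proof of the fundamental lemma for a unitary group*, Canad. J. Math. 50 (1998), Prop. 3 p. 78, §6 p. 97.
-/

noncomputable section

open NumberField IsDedekindDomain Matrix
open scoped MatrixGroups

namespace Literature.NumberTheory.Rogawski1990

open Literature.NumberTheory.Automorphic Literature.NumberTheory.Automorphic.UnitaryGroup
open Literature.NumberTheory.GaloisRepresentations Literature.NumberTheory.NumberFields Literature.NumberTheory.QuadraticForms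
open Literature.AlgebraicGeometry.ShimuraVarieties (unitaryGroup mem_unitaryGroup_iff)

section Support

variable (L : Type) [Field L] [NumberField L] [IsCMField L] (v : HeightOneSpectrum (𝓞 ↥(maximalRealSubfield L)))
  (H' : Matrix (Fin 3) (Fin 3) L)
  (a : (UnitaryGroup.cmDatum L 2 (Matrix.of fun i j : Fin 2 => if i.val + j.val + 1 = 2 then (1 : L) else 0)).Local v ×
      (UnitaryGroup.cmDatum L 1 (Matrix.of fun i j : Fin 1 => if i.val + j.val + 1 = 1 then (1 : L) else 0)).Local v)
  (w : UnitaryGroup.PlacesOver L v) (hw : IsCMField.complexConj L • w.1 = w.1)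

/-- A CM field has a non-zero element negated by complex conjugation. [cite: Rogawski1990, §1.10] -/
private theorem exists_complexConj_eq_neg_ne_zero_supportTwo (L : Type) [Field L] [NumberField L] [IsCMField L] :
    ∃ δ : L, IsCMField.complexConj L δ = -δ ∧ δ ≠ 0 := by
  obtain ⟨ζ, hζ⟩ := not_forall.1 fun h0 => IsCMField.complexConj_ne_one L (AlgEquiv.ext h0)
  refine ⟨ζ - IsCMField.complexConj L ζ, by rw [map_sub, IsCMField.complexConj_apply_apply, neg_sub], fun h0 => hζ ?_⟩
  rw [sub_eq_zero] at h0
  exact h0.symm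

include hw in
/-- **THE `Δ‴`-SUPPORT ON A TYPE-(2) STABLE CLASS IS THE TWO MATCHED CLASSES**: if `t₁, t₂ ∈ G′_v` are matched with `ι_v(γ_H)`, `t₁` has a type-(2) block frame
`t₁ P = P [A 0; 0 u]` with `χ_A` irreducible, and `t₁ ≁ t₂`, then every conjugacy class `c` with `Δ‴_v(γ_H, out c) ≠ 0` is `⟦t₁⟧` or `⟦t₂⟧` (Δ‴ vanishes off the stable
class, which has exactly two classes). [cite: Rogawski1990, §3.5 Prop. 3.5.2 (c) p. 29; §4.3 (4.3.1)–(4.3.2) p. 43] [cite: Flicker1998UnitaryFL, Prop. 3 p. 78] -/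
theorem mk_eq_or_of_finExplicitDelta_out_ne_zero_typeTwo (μ : HeckeCharacter L)
    {t₁ t₂ : (UnitaryGroup.cmDatum L 3 H').Local v}
    (h₁ : IsLocalNormPair L H' v a t₁) (h₂ : IsLocalNormPair L H' v a t₂)
    (hH : (((UnitaryGroup.adelicForm L 3 H').map (UnitaryGroup.adeleToLocal L v)).map
      (UnitaryGroup.conjLocal L (IsCMField.complexConj L) v))ᵀ = (UnitaryGroup.adelicForm L 3 H').map (UnitaryGroup.adeleToLocal L v))
    (hHd : IsUnit ((UnitaryGroup.adelicForm L 3 H').map (UnitaryGroup.adeleToLocal L v)).det) (e : Fin 2 ⊕ Fin 1 ≃ Fin 3)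
    {P : GL (Fin 3) (UnitaryGroup.LocalRing L v)} {A : Matrix (Fin 2) (Fin 2) (UnitaryGroup.LocalRing L v)} {u : UnitaryGroup.LocalRing L v}
    (hP : (t₁.val.val : Matrix (Fin 3) (Fin 3) (UnitaryGroup.LocalRing L v)) * P.val = P.val * reindex e e (fromBlocks A 0 0 !![u]))
    (hA : Irreducible A.charpoly) (h12 : ¬ IsConj t₁ t₂)
    (c : ConjClasses ((UnitaryGroup.cmDatum L 3 H').Local v)) (hc : finExplicitDelta L v H' a μ (Quotient.out c) ≠ 0) :
    c = ConjClasses.mk t₁ ∨ c = ConjClasses.mk t₂ := by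
  obtain ⟨δ, hcδ, hδ⟩ := exists_complexConj_eq_neg_ne_zero_supportTwo L
  -- the stable class of `t₁` has exactly two classes: `t₁`'s and a non-norm corner `δ₀`'s
  obtain ⟨δ₀, -, hnc₀, hall⟩ := exists_isStablyConj_not_isConj_and_forall L v (IsCMField.complexConj L) hcδ hδ e w hw hH hHd t₁.2 hP hA
  have hmk : ConjClasses.mk (⟨(Quotient.out c).val, (Quotient.out c).2⟩ : unitaryGroup (UnitaryGroup.conjLocal L (IsCMField.complexConj L) v)
      ((UnitaryGroup.adelicForm L 3 H').map (UnitaryGroup.adeleToLocal L v))) = c := Quotient.out_eq c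
  -- `out c` and `t₂` are stably conjugate to `t₁`
  have hstc := mk_mem_conjClassesIn_iff.1 (mk_mem_conjClassesIn_of_finExplicitDelta_ne_zero L v H' a t₁ μ h₁ hc)
  have hst₂ := mk_mem_conjClassesIn_iff.1 (mk_mem_conjClassesIn_of_isLocalNormPair L v H' a h₁ h₂)
  rcases hall _ hstc with hc1 | hc0
  · exact Or.inl (by rw [← hmk]; exact (ConjClasses.mk_eq_mk_iff_isConj.2 hc1).symm)
  · rcases hall _ hst₂ with h21 | h20
    · exact absurd h21 h12
    · exact Or.inr (by rw [← hmk]; exact (ConjClasses.mk_eq_mk_iff_isConj.2 (h20.symm.trans hc0)).symm)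

include hw in
/-- **∃-form** of `mk_eq_or_of_finExplicitDelta_out_ne_zero_typeTwo`: the `Δ‴`-support class is one of the two matched classes.
[cite: Rogawski1990, §3.5 Prop. 3.5.2 (c) p. 29; §4.3 (4.3.1)–(4.3.2) p. 43] -/
theorem exists_index_of_finExplicitDelta_ne_zero_typeTwo (μ : HeckeCharacter L)
    {t₁ t₂ : (UnitaryGroup.cmDatum L 3 H').Local v}
    (h₁ : IsLocalNormPair L H' v a t₁) (h₂ : IsLocalNormPair L H' v a t₂)
    (hH : (((UnitaryGroup.adelicForm L 3 H').map (UnitaryGroup.adeleToLocal L v)).map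
      (UnitaryGroup.conjLocal L (IsCMField.complexConj L) v))ᵀ = (UnitaryGroup.adelicForm L 3 H').map (UnitaryGroup.adeleToLocal L v))
    (hHd : IsUnit ((UnitaryGroup.adelicForm L 3 H').map (UnitaryGroup.adeleToLocal L v)).det) (e : Fin 2 ⊕ Fin 1 ≃ Fin 3)
    {P : GL (Fin 3) (UnitaryGroup.LocalRing L v)} {A : Matrix (Fin 2) (Fin 2) (UnitaryGroup.LocalRing L v)} {u : UnitaryGroup.LocalRing L v}
    (hP : (t₁.val.val : Matrix (Fin 3) (Fin 3) (UnitaryGroup.LocalRing L v)) * P.val = P.val * reindex e e (fromBlocks A 0 0 !![u]))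
    (hA : Irreducible A.charpoly) (h12 : ¬ IsConj t₁ t₂)
    (c : ConjClasses ((UnitaryGroup.cmDatum L 3 H').Local v)) (hc : finExplicitDelta L v H' a μ (Quotient.out c) ≠ 0) :
    ∃ i : Fin 2, c = ConjClasses.mk (![t₁, t₂] i) := by
  rcases mk_eq_or_of_finExplicitDelta_out_ne_zero_typeTwo L v H' a w hw μ h₁ h₂ hH hHd e hP hA h12 c hc with h | h
  · exact ⟨0, h⟩
  · exact ⟨1, h⟩

end Support

end Literature.NumberTheory.Rogawski1990

end
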